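import Summits.BirchSwinnertonDyer.BirchSwinnertonDyer.Theorems.ByReductionTypeAtTwoSupersingularFlatLevelCongruencesOfC6
import Literature.NumberTheory.EllipticCurves.Sprung2012.LocalIwasawaModule
import HarnessLib

/-!
# Crux `SupersingularRankZeroAtTwo` (K4, item stmt-BirchSwinnertonDyer-19097), line `odd_blind_package` v2.20 (39efd4f3),
# stub 2/5 `stub_flatPackage : FlatZetaPackageAtTwo` — FILE C1 of hand «hF3-CAP»: THE LEVELWISE CONGRUENCES `hE3` OF THE
# SOCKET, FROM E5, FOR A FAMILY — level-generic (seam S1), for any local lift of the generator (seam S2), in the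
# normalisation of record (seam S3)

Seat `bsd-2adic-t42` GEN 52 (pen GEN 41 SUMMON 20260831T234826Z, director-bsd g27 (1009)(a)/(1010)(a); LEAD ss-1 GEN 26 notes
N1–N3).  HONEST FRAMING (D-0054): THEOREMS ONLY — no definition, no named fact, no instance, no notation, no `sorry`.  Pure
re-keying of tower-1's E5 ★★★ `SSFlatERL.flat_levelCongruences_of_C6` (p837121); every analytic input stays DISPLAYED exactly as
there (the (C6)-shaped pairing values `hV`, Kato's value law `hB2`, the trivial-character value `hB4c`, the cusp multiplier `hμt`).
Helper toward conjunct F3 of stub 2; closes NO stub; 19097 stays OPEN on its 5 registered stubs; nothing booked; BSD₂ is proved for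
no supersingular curve and BSD for no curve by any of this; typed ≠ proved.

## What

The capstone feeds E5 with Kato's data, which the Literature states at the levels `CyclotomicField (cycLevel 2 k ∅) ℚ`
(`Kato2004.exists_eulerSystem_expStar_tatePairing_values_two`, `KatoBK.charSumF_mul_gaussSum_eq_two`,
`SSFlatERL.katoTrivialValuesTwo_brick_of_frobeniusTrace`), while E5 is typed at `CyclotomicField (2 ^ (n + 2)) ℚ`; the two level
expressions are equal (`KatoBK.cycLevel_two_empty`) but not syntactically, so the value fields are distinct types.  And the
f-block of `FlatZetaPackageAtTwo` quantifies over EVERY local lift `g` of the topological generator, while E5's orbit enumeration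
uses the lift attached to the local variable (`LocalVar.exists_localVariable_two`, `χ₂ = 5`).

* §1 `smul_pow_eq_of_isTopGenerator`, `pairingSum_eq_of_isTopGenerator` — two local lifts of the top generator act identically on
  `E(K_∞·K_v)` (both act through `κ`; `localTowerPointsOfEmb` is the fixed group of the preimage of `ker κ`), so Sprung's orbit
  sums `P_{n,x}(z)` over `E(K_∞·K_v)` do not depend on the lift.
* §2 `levelCongruence_smul_class` — the class scaling of the normalisation of record: for a `Λ`-linear `L : H → H¹_Iw` (points
  model, `moduleOfGenerator`), `C D · P_{n,x}(L s) = P_{n,x}(L (C D • s))` (`pairingSum_smul`, `lambdaSMul_C`), and the integer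
  bookkeeping `C((D·q.den : ℤ)) = C(q.den) · C(D)`.
* §3 ★ `hE3_of_C6_family` — E5's congruence (2) for a FAMILY of cusp data `δ : Δ` over a LEVEL FUNCTION `M : ℕ → ℕ` with
  `M n = 2 ^ (n + 2)` (so that `M n := cycLevel 2 (n + 2) ∅` plugs in): per `δ`, Kato's element `xF δ n`, the (C6) values `hV δ`,
  the value law `hB2 δ`, the trivial value `hB4c δ`, Kato's integers `cK δ, dK δ`, the four symbol values, the clearing denominator
  `D δ` and the cusp multiplier `μ̃ δ`; uniform: the Sprung–Honda model data (E0/E0b), the local variable, the carrier, the frame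
  `(e, τ)`, the newform and Kato's constant `q`.  Proof: `funext` + `subst` + E5.
* §4 ★★ `hE3_of_C6` — THE SOCKET SHAPE: carrier `E(K_∞·ℚ_v)` with the functionals `L (x δ)` of the classes
  `x δ := C(D δ) • s δ` (normalisation of record: the per-datum clearing denominator is absorbed into the class), multipliers
  `A δ := C((N·q.num : ℤ)) · μ̃ δ`, common denominator `d := (q.den : ℤ_[2])`, and ANY local lift `g'` of the generator in the
  orbit sums — literally the hypothesis `hE3` of ★ `SSFlatFold.flatZeta_fblock_of_levelCongruences` for this family.

References: [Kato2004Asterisque] K. Kato, Astérisque 295 (2004), Thm. 12.5 (1), Ex. 13.3 (p. 225), §13.9; [Kobayashi2003] (8.23),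
Prop. 8.25–8.26; [Sprung2012] F. Sprung, J. Number Theory 132 (2012), Def. 3.1 (p. 1489), Def. 5.9 (p. 1495), Thm. 2.2;
[MazurTateTeitelbaum1986Invent] §I.10, §I.13; [Washington1997] §13.1–13.2.
-/

set_option autoImplicit false
-- the Theorems namespace of this sub repeats the summit name by design (D-0017 nested layout)
set_option linter.dupNamespace false

noncomputable section

set_option backward.isDefEq.respectTransparency false

open scoped Classical MatrixGroups ModularForm NumberField

namespace Summit.BirchSwinnertonDyer.BirchSwinnertonDyer.Theorems.SSFlatCap

open CongruenceSubgroup WeierstrassCurve Field IsDedekindDomain NumberField Polynomial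
  Literature.NumberTheory.GaloisRepresentations
  Literature.NumberTheory.EllipticCurves Literature.NumberTheory.EllipticCurves.ModularForms
  Literature.NumberTheory.EllipticCurves.Rank1Residual
  Literature.NumberTheory.EllipticCurves.Kobayashi2003 Literature.NumberTheory.EllipticCurves.Kato2004
  Literature.NumberTheory.EllipticCurves.Kato2004.EulerSystemValues Literature.NumberTheory.EllipticCurves.Sprung2012
  Literature.NumberTheory.EllipticCurves.FormalGroupChart
  ZpExtension
  Summit.BirchSwinnertonDyer.Rank1Residual.Additive Summit.BirchSwinnertonDyer.Rank1Residual.Additive.PadicCyclotomicTower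
  Summit.BirchSwinnertonDyer.Rank1Residual.Additive.BallEval
  Summit.BirchSwinnertonDyer.BirchSwinnertonDyer.Theorems.SignedKatoOffTwo.LocalTwo
  Summit.BirchSwinnertonDyer.BirchSwinnertonDyer.Theorems.SignedKatoOffTwo
  Summit.BirchSwinnertonDyer.BirchSwinnertonDyer.Theorems.SignedKatoOffTwo.CoreChi
  Summit.BirchSwinnertonDyer.BirchSwinnertonDyer.Theorems.SignedKatoOffTwo.KatoBK
  Summit.BirchSwinnertonDyer.BirchSwinnertonDyer.Theorems.SSFlatERL

/-! ## §1 Two local lifts of the topological generator act identically on `E(K_∞·K_v)` -/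

section Lift

universe u

variable {K : Type u} [Field K] {p : ℕ} [Fact p.Prime] (κ : ZpExtension K p)
  {E : Type u} [Field E] [Algebra K E] (ι : AlgebraicClosure K →ₐ[K] AlgebraicClosure E) (W : WeierstrassCurve K)

/-- Two elements of `Γ_{K_v}` with the same image under `κ ∘ res` differ by an element of `Gal(K̄_v/K_∞·K_v)`, hence act
identically on `E(K_∞·K_v)`. [cite: Washington1997, §13.1] [cite: Sprung2012, §1 p. 1486] -/
theorem smul_eq_smul_of_apply_resGalOfEmb_eq {σ τ : Field.absoluteGaloisGroup E}
    (h : κ (resGalOfEmb ι σ) = κ (resGalOfEmb ι τ)) {P : localPoints W E} (hP : P ∈ localTowerPointsOfEmb κ ι W) :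
    σ • P = τ • P := by
  have hmem : τ⁻¹ * σ ∈ localSubgroupOfEmb κ.kerSubgroup ι := by
    rw [mem_localSubgroupOfEmb_iff, ZpExtension.mem_kerSubgroup, map_mul, map_inv, map_mul, map_inv, h, inv_mul_cancel]
  have hfix := (mem_localTowerPointsOfEmb_iff κ ι W P).1 hP _ hmem
  calc σ • P = (τ * (τ⁻¹ * σ)) • P := by rw [mul_inv_cancel_left]
    _ = τ • P := by rw [mul_smul, hfix]

/-- **Powers of two local lifts of the topological generator agree on `E(K_∞·K_v)`**: if `κ(res g) = κ(res g') = 1`, then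
`g'ʲ • P = gʲ • P` for every `P ∈ E(K_∞·K_v)`. [cite: Washington1997, §13.1–13.2] [cite: Sprung2012, Def. 3.1 (p. 1489)] -/
theorem smul_pow_eq_of_isTopGenerator {g g' : Field.absoluteGaloisGroup E} (hg : κ.IsTopGenerator (resGalOfEmb ι g))
    (hg' : κ.IsTopGenerator (resGalOfEmb ι g')) {P : localPoints W E} (hP : P ∈ localTowerPointsOfEmb κ ι W) (j : ℕ) :
    g' ^ j • P = g ^ j • P := by
  refine smul_eq_smul_of_apply_resGalOfEmb_eq κ ι W ?_ hP
  rw [map_pow, map_pow, map_pow, map_pow]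
  unfold ZpExtension.IsTopGenerator at hg hg'
  rw [hg, hg']

/-- **Sprung's orbit sums over `E(K_∞·K_v)` do not depend on the lift of the generator**: for `x ∈ E(K_∞·K_v)` and any
subgroup `A` with a functional `z`, `P_{n,x}^{g'}(z) = P_{n,x}^{g}(z)`. [cite: Sprung2012, Def. 3.1 (p. 1489)] -/
theorem pairingSum_eq_of_isTopGenerator {g g' : Field.absoluteGaloisGroup E} (hg : κ.IsTopGenerator (resGalOfEmb ι g))
    (hg' : κ.IsTopGenerator (resGalOfEmb ι g')) (A : AddSubgroup (localPoints W E)) (n : ℕ) {x : localPoints W E}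
    (hx : x ∈ localTowerPointsOfEmb κ ι W) (z : A →+ ℤ_[p]) :
    pairingSum W A g' n x z = pairingSum W A g n x z := by
  rw [pairingSum_def, pairingSum_def]
  exact Finset.sum_congr rfl fun j _ ↦ by rw [smul_pow_eq_of_isTopGenerator κ ι W hg hg' hx j]

/-! ## §2 The class scaling of the normalisation of record -/

/-- **`C D · P_{n,x}(L s) = P_{n,x}(L (C D • s))`** for a `Λ`-linear `L` into the points model `H¹_Iw = (E(K_∞·K_v) →+ ℤ_p)`
(`moduleOfGenerator`: the constants act through `ℤ_p`, `lambdaSMul_C`; `pairingSum_smul`). [cite: Sprung2012, Def. 3.1, Def. 5.9] -/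
theorem pairingSum_map_C_smul {g : Field.absoluteGaloisGroup E} (hg : κ.IsTopGenerator (resGalOfEmb ι g))
    {H : Type*} [AddCommGroup H] [Module (IwasawaAlgebra p) H]
    (L : letI := moduleOfGenerator κ ι W hg; H →ₗ[IwasawaAlgebra p] (localTowerPointsOfEmb κ ι W →+ ℤ_[p]))
    (g₁ : Field.absoluteGaloisGroup E) (n : ℕ) (x : localPoints W E) (D : ℤ_[p]) (s : H) :
    pairingSum W (localTowerPointsOfEmb κ ι W) g₁ n x (L ((PowerSeries.C D : IwasawaAlgebra p) • s)) =
      PowerSeries.C D * pairingSum W (localTowerPointsOfEmb κ ι W) g₁ n x (L s) := by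
  letI := moduleOfGenerator κ ι W hg
  rw [L.map_smul, moduleOfGenerator_smul_eq, lambdaSMul_C, pairingSum_smul]

end Lift

/-- Scaling a levelwise congruence by a constant: from
`C(2^m)·(ι A·Θ − ι(C ν·P)) = ι(Ω q)` to `C(2^m)·(ι A·Θ − ι(C ν'·P')) = ι(Ω q)` whenever `C ν·P = C ν'·P'`; bookkeeping for the
normalisation of record (`ν = D·q.den`, `ν' = q.den`, `P' = P(L (C D • s))`). [folklore] -/
theorem levelCongruence_congr {m : ℕ} {A q Ω P P' : IwasawaAlgebra 2} {ν ν' : ℤ_[2]} {Θ : PowerSeries ℚ_[2]}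
    (h : PowerSeries.C ((2 : ℚ_[2]) ^ m) * (iwasawaToPowerSeries 2 A * Θ - iwasawaToPowerSeries 2 (PowerSeries.C ν * P)) =
      iwasawaToPowerSeries 2 (Ω * q))
    (hP : PowerSeries.C ν * P = PowerSeries.C ν' * P') :
    PowerSeries.C ((2 : ℚ_[2]) ^ m) * (iwasawaToPowerSeries 2 A * Θ - iwasawaToPowerSeries 2 (PowerSeries.C ν' * P')) =
      iwasawaToPowerSeries 2 (Ω * q) := by
  rw [← hP]; exact h

/-! ## §3 E5 for a family of cusp data, over a level function -/

/-- ★ **THE LEVELWISE CONGRUENCES FOR A FAMILY, LEVEL-GENERIC.**  E5's congruence (2) («`∃ m q', C(2^m)(ι μ·θ_n − ι(ν·P_{n,c_n}(w))) =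
ι(ω_n q')`», `ν := C(D·q.den)`, `μ := C(N·q.num)·μ̃`) for EVERY member `δ` of a family of cusp data (Kato's element `xF δ n`, the (C6)
values `hV δ`, the value law `hB2 δ`, the trivial value `hB4c δ`, Kato's odd integers `cK δ, dK δ`, the four symbol values, `D δ`,
`μ̃ δ`) sharing the Sprung–Honda model data, the local variable, the carrier, the frame `(e, τ)`, the newform and Kato's constant
`q` — typed over a LEVEL FUNCTION `M` with `M n = 2 ^ (n + 2)` (the Literature's `cycLevel 2 (n + 2) ∅`).  ONE call of E5 per
`(δ, n)` after `subst`. [cite: Kato2004Asterisque, Thm. 12.5 (1)] [cite: Kobayashi2003, Prop. 8.25–8.26, proof of Thm. 6.3 (p. 25)]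
[cite: Sprung2012, Props. 6.3–6.5] [cite: Pollack2003, Prop. 6.18] -/
theorem hE3_of_C6_family (W : WeierstrassCurve ℚ) [W.IsElliptic] [W.IsGloballyMinimal]
    {κ : ZpExtension ℚ 2} (hκ : κ.IsCyclotomic) (ι : AlgebraicClosure ℚ →ₐ[ℚ] AlgebraicClosure ℚ_[2])
    -- the level function (seam S1)
    {M : ℕ → ℕ} [hM0 : ∀ n, NeZero (M n)] (hM : ∀ n, M n = 2 ^ (n + 2))
    -- the displayed Sprung–Honda data on the `2`-adic model (FILE E0/E0b)
    {x : ℕ → ℚ_[2]} {y : ℕ → localPoints W ℚ_[2]} {σ : ℕ → Field.absoluteGaloisGroup ℚ_[2]} {d₀ : ℕ → localPoints W ℚ_[2]}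
    {N : ℕ} {a : ℤ} (hx0 : x 0 = 1) (hx1 : (2 : ℚ_[2]) * x 1 = a) (hx2 : (2 : ℚ_[2]) * x 2 = a * x 1 - x 0) (hN : (N : ℤ) = 3 - a)
    (hyΩ : haveI := isIntegral_genFib_baseChange 2 ((integralModelInt W).map (Int.castRingHom ℤ_[2]))
        ∀ m, (toLoc ((genFibΩ_eq_baseChange ((integralModelInt W).map (Int.castRingHom ℤ_[2]))).trans
              (baseChange_twoAdicModel W))).symm (y m) ∈
            subfieldPoints (genFibΩ 2 ((integralModelInt W).map (Int.castRingHom ℤ_[2]))) (layer 2 m).toSubfield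
              coeffs_mem_layer ∧
          (toLoc ((genFibΩ_eq_baseChange ((integralModelInt W).map (Int.castRingHom ℤ_[2]))).trans
              (baseChange_twoAdicModel W))).symm (y m) ∈
            kernel (Valued.v (R := PadicAlgCl 2)) (genFibΩ 2 ((integralModelInt W).map (Int.castRingHom ℤ_[2]))) ∧
          ptLogΩ 2 ((integralModelInt W).map (Int.castRingHom ℤ_[2]))
            ((toLoc ((genFibΩ_eq_baseChange ((integralModelInt W).map (Int.castRingHom ℤ_[2]))).trans
              (baseChange_twoAdicModel W))).symm (y m)) =
            ∑ k ∈ Finset.range m, algebraMap ℚ_[2] (PadicAlgCl 2) (x k) * (zeta 2 (m - k) - 1))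
    (hystab : ∀ m, ∀ τ ∈ stab 2 m, τ • y m = y m)
    (hσ : ∀ m, 1 ≤ m → σ m • zeta 2 m = (zeta 2 m)⁻¹)
    (hd₀ : ∀ n, d₀ n = N • (y (n + 2) + σ (n + 2) • y (n + 2)) - 2 • y 1)
    (hL₀ : ∀ m, d₀ m ∈ localLayerPointsOfEmb κ ι W m)
    -- the local variable on the model
    {g₀ : Field.absoluteGaloisGroup ℚ_[2]} (hg₀ : ∀ m j : ℕ, g₀ ^ j • zeta 2 m = zeta 2 m ^ 5 ^ j)
    -- the carrier
    {E : Type} [Field E] [Algebra ℚ E] (ιE : AlgebraicClosure ℚ →ₐ[ℚ] AlgebraicClosure E)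
    {g : Field.absoluteGaloisGroup E} (hg : κ.IsTopGenerator (resGalOfEmb ιE g))
    {c : ℕ → localPoints W E} (hcL : ∀ m, c m ∈ localLayerPointsOfEmb κ ιE W m)
    (hTR : ∀ n, localTraceOfEmb κ ιE W (n + 1) (n + 2) (c (n + 2)) = a • c (n + 1) - c n)
    (A : AddSubgroup (localPoints W E)) (hA : ∀ n j : ℕ, g ^ j • c n ∈ A)
    -- the frame: Kato's embeddings and the Galois family, at the levels `M n`
    (e : ∀ n : ℕ, CyclotomicField (M n) ℚ →ₐ[ℚ] PadicAlgCl 2)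
    (he : ∀ n, e n (IsCyclotomicExtension.zeta (M n) ℚ (CyclotomicField (M n) ℚ)) = zeta 2 (n + 2))
    (τ : ∀ n : ℕ, ZMod (2 ^ (n + 2)) → Field.absoluteGaloisGroup ℚ_[2])
    (hτ : ∀ (n : ℕ) (b : ZMod (2 ^ (n + 2))), IsUnit b → τ n b • zeta 2 (n + 2) = zeta 2 (n + 2) ^ b.val)
    -- the newform and Kato's constant
    {M' : ℕ} [NeZero M'] (f : CuspForm (Gamma0 M') 2) (hf0 : IsNewform0 f) (hQ : coeffField f = ⊥) (h2M : ¬ 2 ∣ M')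
    (ha : cuspCoeff f 2 = (a : ℂ)) (q : ℚ)
    -- THE FAMILY: per cusp datum `δ`, the functional, Kato's element, the (C6) values, Kato's integers, the four symbol values,
    -- Kato's value law, the trivial-character value, the clearing denominator and the cusp multiplier
    {Δ : Type*} (w : Δ → (A →+ ℤ_[2])) (xF : Δ → ∀ n : ℕ, CyclotomicField (M n) ℚ)
    (hV : haveI := isIntegral_genFib_baseChange 2 ((integralModelInt W).map (Int.castRingHom ℤ_[2]))
      ∀ (δ : Δ) (n j : ℕ), algebraMap ℚ_[2] (PadicAlgCl 2) (evalOn W A (w δ) (g ^ j • c n) : ℚ_[2]) =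
        ∑ b : (ZMod (2 ^ (n + 2)))ˣ, τ n (b : ZMod (2 ^ (n + 2))) •
          (ptLogΩ 2 ((integralModelInt W).map (Int.castRingHom ℤ_[2]))
            ((toLoc ((genFibΩ_eq_baseChange ((integralModelInt W).map (Int.castRingHom ℤ_[2]))).trans
              (baseChange_twoAdicModel W))).symm (g₀ ^ j • d₀ n)) * e n (xF δ n)))
    (cK dK : Δ → ℤ) (hcK : ∀ δ, ¬ (2 : ℤ) ∣ cK δ) (hdK : ∀ δ, ¬ (2 : ℤ) ∣ dK δ) (S₁ S₂ S₃ S₄ : Δ → ℚ)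
    (hB2 : ∀ (δ : Δ) (n : ℕ) (ψF : DirichletCharacter (CyclotomicField (M n) ℚ) (M n)), ψF (-1) = 1 → ψF.IsPrimitive →
      (∑ b : (ZMod (M n))ˣ, ψF⁻¹ (b : ZMod (M n)) * sigma (M n) b (xF δ n)) *
          gaussSum ψF (AddChar.zmodChar (M n) (IsCyclotomicExtension.zeta_pow (M n) ℚ (CyclotomicField (M n) ℚ))) =
        (q : CyclotomicField (M n) ℚ) * ratTwistedSymbolSum f ψF *
          ((cK δ : CyclotomicField (M n) ℚ) ^ 2 * (dK δ : CyclotomicField (M n) ℚ) ^ 2 * (S₁ δ : CyclotomicField (M n) ℚ)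
            - (cK δ : CyclotomicField (M n) ℚ) * (dK δ : CyclotomicField (M n) ℚ) ^ 2 * ψF (cK δ : ZMod (M n)) *
              (S₂ δ : CyclotomicField (M n) ℚ)
            - (cK δ : CyclotomicField (M n) ℚ) ^ 2 * (dK δ : CyclotomicField (M n) ℚ) * ψF (dK δ : ZMod (M n)) *
              (S₃ δ : CyclotomicField (M n) ℚ)
            + (cK δ : CyclotomicField (M n) ℚ) * (dK δ : CyclotomicField (M n) ℚ) *
              (ψF (cK δ : ZMod (M n)) * ψF (dK δ : ZMod (M n))) * (S₄ δ : CyclotomicField (M n) ℚ)))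
    (hB4c : ∀ (δ : Δ) (n : ℕ), n ≤ 1 → ∑ b : (ZMod (M n))ˣ, sigma (M n) b (xF δ n) =
      (((3 - (a : ℚ)) / 2 * q * ratPlusSymbol f 0 *
          (cK δ ^ 2 * dK δ ^ 2 * S₁ δ - cK δ * dK δ ^ 2 * S₂ δ - cK δ ^ 2 * dK δ * S₃ δ + cK δ * dK δ * S₄ δ) : ℚ) :
        CyclotomicField (M n) ℚ))
    (D : Δ → ℤ) (μt : Δ → IwasawaAlgebra 2)
    (hμt : ∀ (δ : Δ) (n : ℕ) (χ : DirichletCharacter ℂ_[2] (2 ^ (n + 2))), χ.Even → (∃ j : ℕ, orderOf χ = 2 ^ j) →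
      HasSum (fun k ↦ ((algebraMap ℚ_[2] ℂ_[2]).comp (algebraMap ℤ_[2] ℚ_[2])) (PowerSeries.coeff k (μt δ)) *
          (χ (5 : ZMod (2 ^ (n + 2))) - 1) ^ k)
        ((D δ : ℂ_[2]) * ((cK δ : ℂ_[2]) ^ 2 * (dK δ : ℂ_[2]) ^ 2 * (S₁ δ : ℂ_[2])
          - (cK δ : ℂ_[2]) * (dK δ : ℂ_[2]) ^ 2 * χ (cK δ : ZMod (2 ^ (n + 2))) * (S₂ δ : ℂ_[2])
          - (cK δ : ℂ_[2]) ^ 2 * (dK δ : ℂ_[2]) * χ (dK δ : ZMod (2 ^ (n + 2))) * (S₃ δ : ℂ_[2])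
          + (cK δ : ℂ_[2]) * (dK δ : ℂ_[2]) * (χ (cK δ : ZMod (2 ^ (n + 2))) * χ (dK δ : ZMod (2 ^ (n + 2)))) * (S₄ δ : ℂ_[2]))))
    (δ : Δ) (n : ℕ) :
    ∃ (m : ℕ) (q' : IwasawaAlgebra 2),
      PowerSeries.C ((2 : ℚ_[2]) ^ m) *
          (iwasawaToPowerSeries 2 (PowerSeries.C ((((N : ℤ) * q.num : ℤ) : ℤ_[2])) * μt δ) *
              (((mazurTateElement f 2 n).map (algebraMap ℚ ℚ_[2]) : ℚ_[2][X]) : PowerSeries ℚ_[2]) -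
            iwasawaToPowerSeries 2 (PowerSeries.C (((D δ * q.den : ℤ) : ℤ_[2])) * pairingSum W A g n (c n) (w δ))) =
        iwasawaToPowerSeries 2 ((((cyclotomicOmega 2 n).map (Int.castRingHom ℤ_[2]) : ℤ_[2][X]) : PowerSeries ℤ_[2]) * q') := by
  obtain rfl : M = fun n ↦ 2 ^ (n + 2) := funext hM
  exact (flat_levelCongruences_of_C6 W hκ ι hx0 hx1 hx2 hN hyΩ hystab hσ hd₀ hL₀ hg₀ ιE hg hcL hTR A hA (w δ) e he τ hτ (xF δ)
    (hV δ) f hf0 hQ h2M ha q (hcK δ) (hdK δ) (S₁ δ) (S₂ δ) (S₃ δ) (S₄ δ) (hB2 δ) (hB4c δ) (D δ) (μt δ) (hμt δ) n).2.1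

/-! ## §4 The socket shape: carrier `E(K_∞·K_v)`, classes `C(D δ) • s δ`, common denominator `q.den`, any lift `g'` -/

/-- ★★ **THE HYPOTHESIS `hE3` OF THE F3 SOCKET, FROM E5, IN THE NORMALISATION OF RECORD.**  Same displayed inputs as
`hE3_of_C6_family` with the carrier specialised to `E(K_∞·K_v)` (`localTowerPointsOfEmb κ ιE W`) and the functionals
`w δ := L (s δ)` for a `Λ`-linear `L : H → H¹_Iw` (points model for the lift `g` of E5) and classes `s δ : H`; conclusion, for EVERY
local lift `g'` of the topological generator, every `δ` and `n`:
`∃ m q', C(2^m)·(ι(C((N·q.num:ℤ))·μ̃ δ)·θ̃_n − ι(C(q.den)·P^{g'}_{n,c_n}(L (C(D δ) • s δ)))) = ι(ω_n·q')` — literally the `hE3` of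
★ `SSFlatFold.flatZeta_fblock_of_levelCongruences` for the family `x δ := C(D δ) • s δ`, `A δ := C((N·q.num:ℤ))·μ̃ δ`, `d := q.den`.
(§1: the orbit sums do not see the lift; §2: `C(D·q.den)·P(L s) = C(q.den)·P(L (C D • s))`.)
[cite: Kato2004Asterisque, Thm. 12.5 (1), §13.9 (p. 230)] [cite: Kobayashi2003, Prop. 8.25–8.26] [cite: Sprung2012, Def. 3.1, Def. 5.9, Props. 6.3–6.5] -/
theorem hE3_of_C6 (W : WeierstrassCurve ℚ) [W.IsElliptic] [W.IsGloballyMinimal]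
    {κ : ZpExtension ℚ 2} (hκ : κ.IsCyclotomic) (ι : AlgebraicClosure ℚ →ₐ[ℚ] AlgebraicClosure ℚ_[2])
    -- the level function (seam S1)
    {M : ℕ → ℕ} [hM0 : ∀ n, NeZero (M n)] (hM : ∀ n, M n = 2 ^ (n + 2))
    -- the displayed Sprung–Honda data on the `2`-adic model (FILE E0/E0b)
    {x : ℕ → ℚ_[2]} {y : ℕ → localPoints W ℚ_[2]} {σ : ℕ → Field.absoluteGaloisGroup ℚ_[2]} {d₀ : ℕ → localPoints W ℚ_[2]}
    {N : ℕ} {a : ℤ} (hx0 : x 0 = 1) (hx1 : (2 : ℚ_[2]) * x 1 = a) (hx2 : (2 : ℚ_[2]) * x 2 = a * x 1 - x 0) (hN : (N : ℤ) = 3 - a)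
    (hyΩ : haveI := isIntegral_genFib_baseChange 2 ((integralModelInt W).map (Int.castRingHom ℤ_[2]))
        ∀ m, (toLoc ((genFibΩ_eq_baseChange ((integralModelInt W).map (Int.castRingHom ℤ_[2]))).trans
              (baseChange_twoAdicModel W))).symm (y m) ∈
            subfieldPoints (genFibΩ 2 ((integralModelInt W).map (Int.castRingHom ℤ_[2]))) (layer 2 m).toSubfield
              coeffs_mem_layer ∧
          (toLoc ((genFibΩ_eq_baseChange ((integralModelInt W).map (Int.castRingHom ℤ_[2]))).trans
              (baseChange_twoAdicModel W))).symm (y m) ∈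
            kernel (Valued.v (R := PadicAlgCl 2)) (genFibΩ 2 ((integralModelInt W).map (Int.castRingHom ℤ_[2]))) ∧
          ptLogΩ 2 ((integralModelInt W).map (Int.castRingHom ℤ_[2]))
            ((toLoc ((genFibΩ_eq_baseChange ((integralModelInt W).map (Int.castRingHom ℤ_[2]))).trans
              (baseChange_twoAdicModel W))).symm (y m)) =
            ∑ k ∈ Finset.range m, algebraMap ℚ_[2] (PadicAlgCl 2) (x k) * (zeta 2 (m - k) - 1))
    (hystab : ∀ m, ∀ τ ∈ stab 2 m, τ • y m = y m)
    (hσ : ∀ m, 1 ≤ m → σ m • zeta 2 m = (zeta 2 m)⁻¹)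
    (hd₀ : ∀ n, d₀ n = N • (y (n + 2) + σ (n + 2) • y (n + 2)) - 2 • y 1)
    (hL₀ : ∀ m, d₀ m ∈ localLayerPointsOfEmb κ ι W m)
    -- the local variable on the model
    {g₀ : Field.absoluteGaloisGroup ℚ_[2]} (hg₀ : ∀ m j : ℕ, g₀ ^ j • zeta 2 m = zeta 2 m ^ 5 ^ j)
    -- the carrier: the field, E5's lift `g` (local-variable side) and ANY lift `g'` (f-block side), the system `c`
    {E : Type} [Field E] [Algebra ℚ E] (ιE : AlgebraicClosure ℚ →ₐ[ℚ] AlgebraicClosure E)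
    {g g' : Field.absoluteGaloisGroup E} (hg : κ.IsTopGenerator (resGalOfEmb ιE g)) (hg' : κ.IsTopGenerator (resGalOfEmb ιE g'))
    {c : ℕ → localPoints W E} (hcL : ∀ m, c m ∈ localLayerPointsOfEmb κ ιE W m)
    (hTR : ∀ n, localTraceOfEmb κ ιE W (n + 1) (n + 2) (c (n + 2)) = a • c (n + 1) - c n)
    -- the `Λ`-linear localisation into the points model (for the lift `g`) and the classes
    {H : Type*} [AddCommGroup H] [Module (IwasawaAlgebra 2) H]
    (L : letI := moduleOfGenerator κ ιE W hg; H →ₗ[IwasawaAlgebra 2] (localTowerPointsOfEmb κ ιE W →+ ℤ_[2]))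
    -- the frame: Kato's embeddings and the Galois family, at the levels `M n`
    (e : ∀ n : ℕ, CyclotomicField (M n) ℚ →ₐ[ℚ] PadicAlgCl 2)
    (he : ∀ n, e n (IsCyclotomicExtension.zeta (M n) ℚ (CyclotomicField (M n) ℚ)) = zeta 2 (n + 2))
    (τ : ∀ n : ℕ, ZMod (2 ^ (n + 2)) → Field.absoluteGaloisGroup ℚ_[2])
    (hτ : ∀ (n : ℕ) (b : ZMod (2 ^ (n + 2))), IsUnit b → τ n b • zeta 2 (n + 2) = zeta 2 (n + 2) ^ b.val)
    -- the newform and Kato's constant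
    {M' : ℕ} [NeZero M'] (f : CuspForm (Gamma0 M') 2) (hf0 : IsNewform0 f) (hQ : coeffField f = ⊥) (h2M : ¬ 2 ∣ M')
    (ha : cuspCoeff f 2 = (a : ℂ)) (q : ℚ)
    -- THE FAMILY
    {Δ : Type*} (s : Δ → H) (xF : Δ → ∀ n : ℕ, CyclotomicField (M n) ℚ)
    (hV : haveI := isIntegral_genFib_baseChange 2 ((integralModelInt W).map (Int.castRingHom ℤ_[2]))
      ∀ (δ : Δ) (n j : ℕ), algebraMap ℚ_[2] (PadicAlgCl 2)
          (evalOn W (localTowerPointsOfEmb κ ιE W) (L (s δ)) (g ^ j • c n) : ℚ_[2]) =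
        ∑ b : (ZMod (2 ^ (n + 2)))ˣ, τ n (b : ZMod (2 ^ (n + 2))) •
          (ptLogΩ 2 ((integralModelInt W).map (Int.castRingHom ℤ_[2]))
            ((toLoc ((genFibΩ_eq_baseChange ((integralModelInt W).map (Int.castRingHom ℤ_[2]))).trans
              (baseChange_twoAdicModel W))).symm (g₀ ^ j • d₀ n)) * e n (xF δ n)))
    (cK dK : Δ → ℤ) (hcK : ∀ δ, ¬ (2 : ℤ) ∣ cK δ) (hdK : ∀ δ, ¬ (2 : ℤ) ∣ dK δ) (S₁ S₂ S₃ S₄ : Δ → ℚ)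
    (hB2 : ∀ (δ : Δ) (n : ℕ) (ψF : DirichletCharacter (CyclotomicField (M n) ℚ) (M n)), ψF (-1) = 1 → ψF.IsPrimitive →
      (∑ b : (ZMod (M n))ˣ, ψF⁻¹ (b : ZMod (M n)) * sigma (M n) b (xF δ n)) *
          gaussSum ψF (AddChar.zmodChar (M n) (IsCyclotomicExtension.zeta_pow (M n) ℚ (CyclotomicField (M n) ℚ))) =
        (q : CyclotomicField (M n) ℚ) * ratTwistedSymbolSum f ψF *
          ((cK δ : CyclotomicField (M n) ℚ) ^ 2 * (dK δ : CyclotomicField (M n) ℚ) ^ 2 * (S₁ δ : CyclotomicField (M n) ℚ)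
            - (cK δ : CyclotomicField (M n) ℚ) * (dK δ : CyclotomicField (M n) ℚ) ^ 2 * ψF (cK δ : ZMod (M n)) *
              (S₂ δ : CyclotomicField (M n) ℚ)
            - (cK δ : CyclotomicField (M n) ℚ) ^ 2 * (dK δ : CyclotomicField (M n) ℚ) * ψF (dK δ : ZMod (M n)) *
              (S₃ δ : CyclotomicField (M n) ℚ)
            + (cK δ : CyclotomicField (M n) ℚ) * (dK δ : CyclotomicField (M n) ℚ) *
              (ψF (cK δ : ZMod (M n)) * ψF (dK δ : ZMod (M n))) * (S₄ δ : CyclotomicField (M n) ℚ)))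
    (hB4c : ∀ (δ : Δ) (n : ℕ), n ≤ 1 → ∑ b : (ZMod (M n))ˣ, sigma (M n) b (xF δ n) =
      (((3 - (a : ℚ)) / 2 * q * ratPlusSymbol f 0 *
          (cK δ ^ 2 * dK δ ^ 2 * S₁ δ - cK δ * dK δ ^ 2 * S₂ δ - cK δ ^ 2 * dK δ * S₃ δ + cK δ * dK δ * S₄ δ) : ℚ) :
        CyclotomicField (M n) ℚ))
    (D : Δ → ℤ) (μt : Δ → IwasawaAlgebra 2)
    (hμt : ∀ (δ : Δ) (n : ℕ) (χ : DirichletCharacter ℂ_[2] (2 ^ (n + 2))), χ.Even → (∃ j : ℕ, orderOf χ = 2 ^ j) →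
      HasSum (fun k ↦ ((algebraMap ℚ_[2] ℂ_[2]).comp (algebraMap ℤ_[2] ℚ_[2])) (PowerSeries.coeff k (μt δ)) *
          (χ (5 : ZMod (2 ^ (n + 2))) - 1) ^ k)
        ((D δ : ℂ_[2]) * ((cK δ : ℂ_[2]) ^ 2 * (dK δ : ℂ_[2]) ^ 2 * (S₁ δ : ℂ_[2])
          - (cK δ : ℂ_[2]) * (dK δ : ℂ_[2]) ^ 2 * χ (cK δ : ZMod (2 ^ (n + 2))) * (S₂ δ : ℂ_[2])
          - (cK δ : ℂ_[2]) ^ 2 * (dK δ : ℂ_[2]) * χ (dK δ : ZMod (2 ^ (n + 2))) * (S₃ δ : ℂ_[2])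
          + (cK δ : ℂ_[2]) * (dK δ : ℂ_[2]) * (χ (cK δ : ZMod (2 ^ (n + 2))) * χ (dK δ : ZMod (2 ^ (n + 2)))) * (S₄ δ : ℂ_[2]))))
    (δ : Δ) (n : ℕ) :
    ∃ (m : ℕ) (q' : IwasawaAlgebra 2),
      PowerSeries.C ((2 : ℚ_[2]) ^ m) *
          (iwasawaToPowerSeries 2 (PowerSeries.C ((((N : ℤ) * q.num : ℤ) : ℤ_[2])) * μt δ) *
              (((mazurTateElement f 2 n).map (algebraMap ℚ ℚ_[2]) : ℚ_[2][X]) : PowerSeries ℚ_[2]) -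
            iwasawaToPowerSeries 2 (PowerSeries.C ((q.den : ℤ) : ℤ_[2]) *
              pairingSum W (localTowerPointsOfEmb κ ιE W) g' n (c n)
                (L ((PowerSeries.C ((D δ : ℤ) : ℤ_[2]) : IwasawaAlgebra 2) • s δ)))) =
        iwasawaToPowerSeries 2 ((((cyclotomicOmega 2 n).map (Int.castRingHom ℤ_[2]) : ℤ_[2][X]) : PowerSeries ℤ_[2]) * q') := by
  letI := moduleOfGenerator κ ιE W hg
  -- the orbit `gʲ • c n` stays in `E(K_∞·K_v)`
  have hcT : ∀ n, c n ∈ localTowerPointsOfEmb κ ιE W := fun n ↦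
    localLayerPointsOfEmb_le_localTowerPointsOfEmb κ ιE W n (hcL n)
  have hA : ∀ n j : ℕ, g ^ j • c n ∈ localTowerPointsOfEmb κ ιE W := fun n j ↦
    smul_mem_localTowerPointsOfEmb κ ιE W (g ^ j) (hcT n)
  obtain ⟨m, q', h⟩ := hE3_of_C6_family W hκ ι hM hx0 hx1 hx2 hN hyΩ hystab hσ hd₀ hL₀ hg₀ ιE hg hcL hTR
    (localTowerPointsOfEmb κ ιE W) hA e he τ hτ f hf0 hQ h2M ha q (fun δ ↦ L (s δ)) xF hV cK dK hcK hdK S₁ S₂ S₃ S₄ hB2 hB4c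
    D μt hμt δ n
  refine ⟨m, q', levelCongruence_congr h ?_⟩
  rw [pairingSum_eq_of_isTopGenerator κ ιE W hg hg' _ n (hcT n), pairingSum_map_C_smul κ ιE W hg L, ← mul_assoc, ← map_mul,
    Int.cast_mul, mul_comm ((D δ : ℤ) : ℤ_[2])]

end Summit.BirchSwinnertonDyer.BirchSwinnertonDyer.Theorems.SSFlatCap

end
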